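import Mathlib
import Literature.Analysis.FluidPDE.VectorCalculus
import Summits.NavierStokesRegularity.NavierStokesRegularity.Theorems.UnthreadedDoorFluxStarvedDipolePotentialCalculus
import Summits.NavierStokesRegularity.NavierStokesRegularity.Theorems.UnthreadedDoorAntidynamoEvenRungRadialPsi
import Summits.NavierStokesRegularity.NavierStokesRegularity.Theorems.UnthreadedDoorNetFluxSphericalExtremumLaplacian
import HarnessLib

/-!
# Route `UnthreadedDoor`, crux `PoloidalLiouville` (stmt-NavierStokesRegularity-1222), wall W1 — crux idea
# «flux-starved-dipoles» (ns-idea-15 g12/g13, `Cruxes/PoloidalLiouville/FluxStarvedDipoleSketch.lean`):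
# the POLE IDENTITY from shell tangency (PDE half of `AmplitudeLawSteady`, K1 `DipoleNeverSteady`)

The sketch composes K1 (`DipoleNeverSteady`: no steady toroidal dipole `B = A(r) × ξ` is maintained on `ℝ³` by a `C¹`
incompressible drift) as `AmplitudeLawSteady → ConvexEndgame → DipoleNeverSteady`; `ConvexEndgame` is p836018 and the ODE half of
`AmplitudeLawSteady` is p836154 (`amplitude_law_of_poleIdentity`: the pole identity `⟪A″ + (2/r)A′ − (2/r²)A, A⟫(r) = 0` gives
`w ∈ C²`, `w″ ≥ 2w/r²` for `w = r‖A‖`).  THIS FILE proves the PDE half named in the card (§Proof step 4, "flux starvation + the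
reduced scalar law evaluated at the two poles `±Â(r)`"):

`FluxStarvedDipole.poleIdentity_of_shellTangent`: for a `C¹` drift `u`, `A, R ∈ C³(0,∞)`, the dipole potential
`T(x) = ⟪A(‖x−x₀‖), x−x₀⟫/‖x−x₀‖ + R(‖x−x₀‖)` and the STEADY KINEMATIC LAW `∇(⟪u,∇T⟫ − ΔT) × (x−x₀) = ∇⟪u, x−x₀⟫ × ∇T` on
`{x₀}ᶜ` (the sketch's `SteadyKinematicLawOn u (dipolePotential x₀ A R) x₀ {x₀}ᶜ`, unfolded): if `u` is tangent to the spheres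
`S_s(x₀)` for all `s` near `r > 0` and `A(r) ≠ 0`, then `⟪A″(r) + (2/r)A′(r) − (2/r²)A(r), A(r)⟫ = 0` — exactly the hypothesis
`hℓ` of `amplitude_law_of_poleIdentity`.

Proof.  On the shell `⟪u, x−x₀⟫ ≡ 0`, so `∇⟪u, x−x₀⟫ = 0` and the law says `∇L × (x−x₀) = 0`, `L := ⟪u,∇T⟫ − ΔT`; `L` is
differentiable off the centre (`T ∈ C³`), so `L` is constant on `S_r(x₀)` (`Antidynamo.sphereConst_of_cross_gradient_eq_zero_on`
of the even-rung file `…AntidynamoEvenRungRadialPsi`).  At the poles `p± = x₀ ± rÂ(r)` the drift is tangent and the tangential derivative of `T`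
vanishes (`dipole_fderiv_apply_eq_zero`), so `⟪u,∇T⟫(p±) = 0` and `ΔT(p₊) = ΔT(p₋)`.  In a radial orthonormal frame
`b = (Â, e₁, e₂)` (`NetFlux.exists_orthonormalBasis_radial`) `dipole_laplacian_sphere` gives `ΔT(x₀ + y) = Σᵢ ⟪bᵢ,y⟫Cᵢ + D` on
`S_r`, so the difference of the pole values is `2rC₀ = 2⟪A″ + (2/r)A′ − (2/r²)A, Â⟫ = 0`.

What remains for `AmplitudeLawSteady` / K1 after this file: the shell tangency itself, i.e. the sketch Prop
`FluxStarvationSteady` (zero net flux through spheres + latitude-circle averaging; XL), and the bookkeeping at solid radii.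

HONEST LABEL: linear kinematic shadow of W1 (critic V28: information-grade, W1 movement 0); `AmplitudeLawSteady`,
`FluxStarvationSteady`, K1, `PoloidalLiouville` (1222), its wall `stub_scalarLiouville` and the summit stay OPEN; NO Navier–Stokes
regularity statement is proved.  `--supports stmt-NavierStokesRegularity-1222` (helper).  [folklore]
-/

noncomputable section

-- the summit and its single sub-problem share the name (CONVENTIONS §1)
set_option linter.dupNamespace false

open Set Filter Topology InnerProductSpace
open scoped RealInnerProductSpace Laplacian
open Literature.Analysis.FluidPDE

namespace Summit.NavierStokesRegularity.NavierStokesRegularity.Theorems.PoloidalLiouville.FluxStarvedDipole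

/-! ### The pole identity -/

/-- **POLE IDENTITY FROM SHELL TANGENCY** (PDE half of the sketch Prop `AmplitudeLawSteady`, crux card
«flux-starved-dipoles», K1 `DipoleNeverSteady`, §Proof step 4).  Let `u ∈ C¹(ℝ³; ℝ³)` be a drift and
`T(x) = ⟪A(‖x−x₀‖), x−x₀⟫/‖x−x₀‖ + R(‖x−x₀‖)` a turning-axis toroidal dipole potential, `A, R ∈ C³(0,∞)`, satisfying the
STEADY KINEMATIC LAW `∇(⟪u,∇T⟫ − ΔT) × (x − x₀) = ∇⟪u, x − x₀⟫ × ∇T` off the centre (the shape of the sketch's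
`SteadyKinematicLawOn u (dipolePotential x₀ A R) x₀ {x₀}ᶜ`, unfolded).  If `u` is TANGENT to the spheres `S_s(x₀)` for all
`s` near `r > 0` (which flux starvation supplies at non-solid radii) and `A(r) ≠ 0`, then
`⟪A″(r) + (2/r)A′(r) − (2/r²)A(r), A(r)⟫ = 0`.
Proof: on the shell `⟪u, x−x₀⟫ ≡ 0`, so the law says `∇(⟪u,∇T⟫ − ΔT)` is radial there and `⟪u,∇T⟫ − ΔT` is constant on
`S_r(x₀)`; at the two poles `x₀ ± rÂ(r)` the tangential derivative of `T` vanishes, so `⟪u,∇T⟫ = 0` there, whence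
`ΔT(x₀ + rÂ) = ΔT(x₀ − rÂ)`; in an orthonormal frame `(Â, e₁, e₂)` the Laplacian on `S_r` is `Σᵢ ⟪bᵢ,y⟫Cᵢ + D` with
`C₀ = ⟪A″ + (2/r)A′ − (2/r²)A, Â⟫/r`, and the difference of the two pole values is `2rC₀`.  [folklore] -/
theorem poleIdentity_of_shellTangent (u : (EuclideanSpace ℝ (Fin 3)) → (EuclideanSpace ℝ (Fin 3))) (x₀ : (EuclideanSpace ℝ (Fin 3))) (A : ℝ → (EuclideanSpace ℝ (Fin 3))) (R : ℝ → ℝ)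
    (hu : ContDiff ℝ 1 u) (hA : ContDiffOn ℝ 3 A (Set.Ioi 0)) (hR : ContDiffOn ℝ 3 R (Set.Ioi 0))
    (hlaw : ∀ x ∈ ({x₀}ᶜ : Set (EuclideanSpace ℝ (Fin 3))),
      cross (gradient (fun z => ⟪u z, gradient (fun x => ⟪A ‖x - x₀‖, x - x₀⟫ / ‖x - x₀‖ + R ‖x - x₀‖) z⟫
          - Δ (fun x => ⟪A ‖x - x₀‖, x - x₀⟫ / ‖x - x₀‖ + R ‖x - x₀‖) z) x) (x - x₀)
        = cross (gradient (fun z => ⟪u z, z - x₀⟫) x)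
            (gradient (fun x => ⟪A ‖x - x₀‖, x - x₀⟫ / ‖x - x₀‖ + R ‖x - x₀‖) x))
    {r : ℝ} (hr : 0 < r) (hAr : A r ≠ 0)
    (htan : ∀ᶠ s in 𝓝 r, ∀ x, ‖x - x₀‖ = s → ⟪u x, x - x₀⟫ = 0) :
    ⟪iteratedDeriv 2 A r + (2 / r) • deriv A r - (2 / r ^ 2) • A r, A r⟫ = 0 := by
  -- abbreviations
  set T : (EuclideanSpace ℝ (Fin 3)) → ℝ := fun x => ⟪A ‖x - x₀‖, x - x₀⟫ / ‖x - x₀‖ + R ‖x - x₀‖ with hTdef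
  have hT : ∀ z, T z = ⟪A ‖z - x₀‖, z - x₀⟫ / ‖z - x₀‖ + R ‖z - x₀‖ := fun z => rfl
  set L : (EuclideanSpace ℝ (Fin 3)) → ℝ := fun z => ⟪u z, gradient T z⟫ - (Δ T) z with hLdef
  -- (1) the shell of tangency
  obtain ⟨ε, hε, hball⟩ := Metric.eventually_nhds_iff.mp htan
  have hshell_open : IsOpen {z : (EuclideanSpace ℝ (Fin 3)) | dist ‖z - x₀‖ r < min ε r} :=
    isOpen_lt ((continuous_norm.comp (continuous_id.sub continuous_const)).dist continuous_const)
      continuous_const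
  have hgradm : ∀ x : (EuclideanSpace ℝ (Fin 3)), dist ‖x - x₀‖ r < min ε r → gradient (fun z => ⟪u z, z - x₀⟫) x = 0 := by
    intro x hx
    have hev : (fun z => ⟪u z, z - x₀⟫) =ᶠ[𝓝 x] fun _ => (0 : ℝ) := by
      filter_upwards [hshell_open.mem_nhds hx] with z hz
      exact hball (lt_of_lt_of_le hz (min_le_left _ _)) z rfl
    rw [gradient, hev.fderiv_eq, fderiv_const_apply, map_zero]
  -- (2) on the shell the law makes `∇L` radial
  have hLrad : ∀ x : (EuclideanSpace ℝ (Fin 3)), dist ‖x - x₀‖ r < min ε r → cross (gradient L x) (x - x₀) = 0 := by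
    intro x hx
    have hxne : x ≠ x₀ := by
      intro h
      rw [h, sub_self, norm_zero, Real.dist_eq, zero_sub, abs_neg, abs_of_pos hr] at hx
      exact absurd (lt_of_lt_of_le hx (min_le_right _ _)) (lt_irrefl _)
    have h := hlaw x hxne
    rw [hgradm x hx, ← crossCLM_apply (0 : (EuclideanSpace ℝ (Fin 3))), map_zero, zero_apply] at h
    exact h
  -- (3) `L` is differentiable off the centre
  have hLdiff : ∀ x : (EuclideanSpace ℝ (Fin 3)), x ≠ x₀ → DifferentiableAt ℝ L x := by
    intro x hx
    have h3 := dipole_contDiffAt hT hA hR hx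
    exact ((hu.differentiable one_ne_zero x).inner ℝ (dipole_differentiableAt_gradient h3)).sub
      (dipole_differentiableAt_laplacian h3)
  -- (4) the unit axis `n = Â(r)` and sphere constancy of `L` on `S_r(x₀)`
  set n : (EuclideanSpace ℝ (Fin 3)) := ‖A r‖⁻¹ • A r with hn
  have hAn0 : ‖A r‖ ≠ 0 := norm_ne_zero_iff.mpr hAr
  have hn1 : ‖n‖ = 1 := by rw [hn, norm_smul, norm_inv, norm_norm, inv_mul_cancel₀ hAn0]
  have hAn : A r = ‖A r‖ • n := by rw [hn, smul_smul, mul_inv_cancel₀ hAn0, one_smul]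
  clear_value n
  have hnorm : ∀ s : ℝ, s = r ∨ s = -r → ‖s • n‖ = r := by
    rintro s (h | h)
    · rw [h, norm_smul, hn1, mul_one, Real.norm_eq_abs, abs_of_pos hr]
    · rw [h, norm_smul, hn1, mul_one, norm_neg, Real.norm_eq_abs, abs_of_pos hr]
  have hpole : L (x₀ + r • n) = L (x₀ + (-r) • n) := by
    have hQd : ∀ y : (EuclideanSpace ℝ (Fin 3)), ‖y‖ = r → DifferentiableAt ℝ (fun y => L (x₀ + y)) y := by
      intro y hy
      have hy0 : x₀ + y ≠ x₀ := by
        intro h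
        have : y = 0 := by simpa using h
        rw [this, norm_zero] at hy
        exact hr.ne' hy.symm
      exact (differentiableAt_comp_add_left x₀).mpr (hLdiff _ hy0)
    have hQr : ∀ y : (EuclideanSpace ℝ (Fin 3)), ‖y‖ = r → cross (gradient (fun y => L (x₀ + y)) y) y = 0 := by
      intro y hy
      have hg : gradient (fun y => L (x₀ + y)) y = gradient L (x₀ + y) := by
        simp only [gradient, fderiv_comp_add_left]
      have hmem : dist ‖(x₀ + y) - x₀‖ r < min ε r := by
        rw [add_sub_cancel_left, hy, dist_self]; positivity
      have h := hLrad (x₀ + y) hmem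
      rw [add_sub_cancel_left] at h
      rw [hg]; exact h
    exact Antidynamo.sphereConst_of_cross_gradient_eq_zero_on hr hQd hQr (hnorm r (Or.inl rfl))
      (hnorm (-r) (Or.inr rfl))
  -- (5) at the poles `⟪u, ∇T⟫ = 0`
  have htan_r : ∀ x, ‖x - x₀‖ = r → ⟪u x, x - x₀⟫ = 0 := hball (by rw [dist_self]; exact hε)
  have hinner0 : ∀ s : ℝ, s = r ∨ s = -r → ⟪u (x₀ + s • n), gradient T (x₀ + s • n)⟫ = 0 := by
    intro s hs
    have hs0 : s ≠ 0 := by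
      rcases hs with h | h
      · rw [h]; exact hr.ne'
      · rw [h]; exact neg_ne_zero.mpr hr.ne'
    have hnrm : ‖x₀ + s • n - x₀‖ = r := by rw [add_sub_cancel_left]; exact hnorm s hs
    have hp : x₀ + s • n ≠ x₀ := by
      intro h
      have h' : ‖x₀ + s • n - x₀‖ = 0 := by rw [h, sub_self, norm_zero]
      rw [hnrm] at h'
      exact hr.ne' h'
    have hw : ⟪x₀ + s • n - x₀, u (x₀ + s • n)⟫ = 0 := by
      rw [real_inner_comm]; exact htan_r _ hnrm
    have hAw : ⟪A ‖x₀ + s • n - x₀‖, u (x₀ + s • n)⟫ = 0 := by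
      have hsn : ⟪s • n, u (x₀ + s • n)⟫ = 0 := by rwa [add_sub_cancel_left] at hw
      rw [real_inner_smul_left] at hsn
      have hn0 : ⟪n, u (x₀ + s • n)⟫ = 0 := (mul_eq_zero.mp hsn).resolve_left hs0
      rw [hnrm, hAn, real_inner_smul_left, hn0, mul_zero]
    rw [real_inner_comm, gradient, InnerProductSpace.toDual_symm_apply]
    exact dipole_fderiv_apply_eq_zero hT hA hR hp hw hAw
  -- (6) the Laplacian at the two poles in an adapted frame
  obtain ⟨b, hb0, -, hb1, hb2⟩ := NetFlux.exists_orthonormalBasis_radial hn1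
  obtain ⟨C, D, hC, hΔ⟩ := dipole_laplacian_sphere hT hA hR b hr
  have hΔs : ∀ s : ℝ, s = r ∨ s = -r → (Δ T) (x₀ + s • n) = s * C 0 + D := by
    intro s hs
    rw [hΔ (s • n) (hnorm s hs), Fin.sum_univ_three, hb0, real_inner_smul_right, real_inner_smul_right,
      real_inner_smul_right, hb1, hb2, real_inner_self_eq_norm_sq, hn1]
    ring
  -- (7) assemble: `L(p₊) = L(p₋)` and `⟪u,∇T⟫(p±) = 0` give `ΔT(p₊) = ΔT(p₋)`, i.e. `2 r C₀ = 0`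
  have hC0 : C 0 = 0 := by
    have h1 := hinner0 r (Or.inl rfl)
    have h2 := hinner0 (-r) (Or.inr rfl)
    have h3 := hΔs r (Or.inl rfl)
    have h4 := hΔs (-r) (Or.inr rfl)
    have h5 : L (x₀ + r • n) = ⟪u (x₀ + r • n), gradient T (x₀ + r • n)⟫ - (Δ T) (x₀ + r • n) := rfl
    have h6 : L (x₀ + (-r) • n) = ⟪u (x₀ + (-r) • n), gradient T (x₀ + (-r) • n)⟫ - (Δ T) (x₀ + (-r) • n) :=
      rfl
    have h7 : r * C 0 = 0 := by linarith [hpole, h1, h2, h3, h4, h5, h6]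
    rcases mul_eq_zero.mp h7 with h | h
    · exact absurd h hr.ne'
    · exact h
  -- (8) the pole identity
  have hval := hC 0
  rw [hC0, hb0] at hval
  have hX : ⟪iteratedDeriv 2 A r + (2 / r) • deriv A r - (2 / r ^ 2) • A r, n⟫ = 0 := by
    have h := hval.symm
    rw [div_eq_zero_iff] at h
    rcases h with h | h
    · rw [inner_sub_left, inner_add_left, real_inner_smul_left, real_inner_smul_left]
      exact h
    · exact absurd h hr.ne'
  rw [hn, inner_smul_right] at hX
  rcases mul_eq_zero.mp hX with h | h
  · exact absurd h (inv_ne_zero hAn0)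
  · exact h

end Summit.NavierStokesRegularity.NavierStokesRegularity.Theorems.PoloidalLiouville.FluxStarvedDipole

end
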